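import Mathlib.Analysis.SpecialFunctions.Complex.Circle
import Mathlib.Topology.Algebra.ContinuousMonoidHom
import Literature.Probability.LatticeModels.GinibrePositiveKernels
import HarnessLib

/-!
# Ginibre's inequality, algebraic part: duplication map, characters, the rotator model and
the duplicated integrand

Companion of `GinibreInequality.lean` (which proves the inequality); this file contains the
measure-free part of Ginibre's argument (J. Ginibre, *General formulation of Griffiths'
inequalities*, Comm. Math. Phys. 16 (1970) 310–328, main theorem and the plane-rotator example)
in the generality of a commutative topological group `Ω` with continuous unitary characters
`χ : Ω →ₜ* U(1)` (for the torus `U(1)^E`, `Re χ = cos(m·φ)`):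

* `dupHom : Ω × Ω →* Ω × Ω`, `(φ, ψ) ↦ (φψ, φψ⁻¹)` (Ginibre's `θ = φ + ψ`, `θ' = φ − ψ`),
  surjective when every element of `Ω` is a square (`dupHom_surjective`);
* `reChar χ = Re χ`, `imChar χ = Im χ` with the addition formulas and the duplication identities
  `Re χ(φψ) ± Re χ(φψ⁻¹)`;
* the model: `ginibreHamiltonian χ J = ∑ₐ Jₐ Re χₐ`, `ginibreWeight = exp ∘ ginibreHamiltonian`,
  the Gibbs expectation `ginibreExpect μ χ J F`;
* the duplicated integrand `ginibreIntegrand χ χ₀ δ γ (φ, ψ) = 4 Im χ₀(φ)Im χ₀(ψ) sinh B exp C`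
  (`B = ∑ δₐ Im χₐ(φ)Im χₐ(ψ)`, `C = ∑ γₐ Re χₐ(φ)Re χₐ(ψ)`), its truncations `ginibreTrunc`
  (positive kernels: `isPosKernel_ginibreTrunc`; uniform bound `abs_ginibreTrunc_le`; convergence
  `tendsto_ginibreTrunc`), and **`ginibre_key`**: the pull-back of
  `(f(θ) − f(θ'))(e^{K(θ)} − e^{K(θ')}) e^{H(θ)} e^{H(θ')}` under the duplication map is
  `ginibreIntegrand χ χ₀ δ (δ + 2J)`.
-/

noncomputable section

open MeasureTheory Filter Finset
open scoped Topology BigOperators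

namespace Literature.Probability.LatticeModels

/-! ### Ginibre's duplication map (pure algebra) -/

section Duplication

variable {Ω : Type*} [CommGroup Ω]

/-- **Ginibre's duplication map** `(φ, ψ) ↦ (φψ, φψ⁻¹)` on `Ω × Ω`, a group endomorphism of the
abelian group `Ω × Ω` (Ginibre 1970: the change of variables `θ = φ + ψ`, `θ' = φ − ψ` in the
duplicated system). [cite: Ginibre1970, main theorem with the plane-rotator example cos(m·φ)] -/
def dupHom : Ω × Ω →* Ω × Ω where
  toFun p := (p.1 * p.2, p.1 * p.2⁻¹)
  map_one' := by simp
  map_mul' p q := by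
    ext
    · exact mul_mul_mul_comm _ _ _ _
    · change p.1 * q.1 * (p.2 * q.2)⁻¹ = p.1 * p.2⁻¹ * (q.1 * q.2⁻¹)
      rw [mul_inv, mul_mul_mul_comm]

/-- `dupHom (φ, ψ) = (φψ, φψ⁻¹)`. [folklore] -/
@[simp] theorem dupHom_apply (p : Ω × Ω) : dupHom p = (p.1 * p.2, p.1 * p.2⁻¹) := rfl

/-- The duplication map is surjective as soon as `Ω` is 2-divisible (every element is a
square; true for tori `U(1)^E`): given `(θ, θ')` pick `ψ² = θθ'⁻¹` and `φ = θψ⁻¹`. [folklore] -/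
theorem dupHom_surjective (h2 : Function.Surjective fun ψ : Ω => ψ * ψ) :
    Function.Surjective (dupHom : Ω × Ω → Ω × Ω) := by
  rintro ⟨θ, θ'⟩
  obtain ⟨ψ, hψ⟩ := h2 (θ * θ'⁻¹)
  refine ⟨(θ * ψ⁻¹, ψ), ?_⟩
  simp only [dupHom_apply, inv_mul_cancel_right, Prod.mk.injEq, true_and]
  have hψ' : ψ * ψ = θ * θ'⁻¹ := hψ
  calc θ * ψ⁻¹ * ψ⁻¹ = θ * (ψ * ψ)⁻¹ := by rw [mul_inv, mul_assoc]
    _ = θ' := by rw [hψ', mul_inv, inv_inv, mul_comm θ⁻¹ θ', mul_comm, mul_assoc,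
        inv_mul_cancel, mul_one]

end Duplication

/-! ### Characters of a compact abelian group: real and imaginary parts -/

section Characters

variable {Ω : Type*} [CommGroup Ω] [TopologicalSpace Ω]

/-- The real part `Re χ(θ)` of a continuous unitary character `χ : Ω → U(1)`; for the torus
`Ω = U(1)^E` and `χ(θ) = ∏ₑ θₑ^{mₑ}` this is Ginibre's `cos(m·φ)` (Ginibre 1970, plane-rotator
example). [cite: Ginibre1970, main theorem with the plane-rotator example cos(m·φ)] -/
def reChar (χ : Ω →ₜ* Circle) (θ : Ω) : ℝ :=
  ((χ θ : Circle) : ℂ).re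

/-- The imaginary part `Im χ(θ)` of a continuous unitary character (`sin(m·φ)` for rotators).
[cite: Ginibre1970, main theorem with the plane-rotator example cos(m·φ)] -/
def imChar (χ : Ω →ₜ* Circle) (θ : Ω) : ℝ :=
  ((χ θ : Circle) : ℂ).im

/-- `Re χ` is continuous. [folklore] -/
theorem continuous_reChar (χ : Ω →ₜ* Circle) : Continuous (reChar χ) :=
  Complex.continuous_re.comp (continuous_subtype_val.comp (map_continuous χ))

/-- `Im χ` is continuous. [folklore] -/
theorem continuous_imChar (χ : Ω →ₜ* Circle) : Continuous (imChar χ) :=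
  Complex.continuous_im.comp (continuous_subtype_val.comp (map_continuous χ))

/-- `|Re χ| ≤ 1`. [folklore] -/
theorem abs_reChar_le_one (χ : Ω →ₜ* Circle) (θ : Ω) : |reChar χ θ| ≤ 1 :=
  (Complex.abs_re_le_norm _).trans_eq (Circle.norm_coe _)

/-- `|Im χ| ≤ 1`. [folklore] -/
theorem abs_imChar_le_one (χ : Ω →ₜ* Circle) (θ : Ω) : |imChar χ θ| ≤ 1 :=
  (Complex.abs_im_le_norm _).trans_eq (Circle.norm_coe _)

/-- Addition formula `Re χ(φψ) = Re χ(φ) Re χ(ψ) − Im χ(φ) Im χ(ψ)` (`cos(a+b)`). [folklore] -/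
theorem reChar_mul (χ : Ω →ₜ* Circle) (φ ψ : Ω) :
    reChar χ (φ * ψ) = reChar χ φ * reChar χ ψ - imChar χ φ * imChar χ ψ := by
  simp [reChar, imChar, map_mul, Circle.coe_mul, Complex.mul_re]

/-- Subtraction formula `Re χ(φψ⁻¹) = Re χ(φ) Re χ(ψ) + Im χ(φ) Im χ(ψ)` (`cos(a−b)`). [folklore] -/
theorem reChar_mul_inv (χ : Ω →ₜ* Circle) (φ ψ : Ω) :
    reChar χ (φ * ψ⁻¹) = reChar χ φ * reChar χ ψ + imChar χ φ * imChar χ ψ := by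
  simp [reChar, imChar, map_mul, map_inv, Circle.coe_mul, Complex.mul_re]

/-- Ginibre's duplication identity `Re χ(φψ) + Re χ(φψ⁻¹) = 2 Re χ(φ) Re χ(ψ)`. [folklore] -/
theorem reChar_mul_add_reChar_mul_inv (χ : Ω →ₜ* Circle) (φ ψ : Ω) :
    reChar χ (φ * ψ) + reChar χ (φ * ψ⁻¹) = 2 * (reChar χ φ * reChar χ ψ) := by
  rw [reChar_mul, reChar_mul_inv]; ring

/-- Ginibre's duplication identity `Re χ(φψ) − Re χ(φψ⁻¹) = −2 Im χ(φ) Im χ(ψ)`. [folklore] -/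
theorem reChar_mul_sub_reChar_mul_inv (χ : Ω →ₜ* Circle) (φ ψ : Ω) :
    reChar χ (φ * ψ) - reChar χ (φ * ψ⁻¹) = -2 * (imChar χ φ * imChar χ ψ) := by
  rw [reChar_mul, reChar_mul_inv]; ring

end Characters

/-! ### The generalised plane-rotator model -/

section Model

variable {Ω : Type*} [CommGroup Ω] [TopologicalSpace Ω] {ι : Type*} [Fintype ι]

/-- The (negative) Hamiltonian `∑ₐ Jₐ Re χₐ(θ)` of a generalised plane-rotator / compact
abelian lattice model with interaction characters `χₐ` and couplings `Jₐ` (Ginibre 1970,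
plane-rotator example `−H = ∑ J_A cos(m_A·φ)`; for `U(1)` lattice gauge theory the `χₐ` are the
plaquette holonomies and `−H = β ∑ₚ cos θₚ`). [cite: Ginibre1970, main theorem with the plane-rotator example cos(m·φ)] -/
def ginibreHamiltonian (χ : ι → Ω →ₜ* Circle) (J : ι → ℝ) (θ : Ω) : ℝ :=
  ∑ a, J a * reChar (χ a) θ

/-- The Gibbs weight `exp(∑ₐ Jₐ Re χₐ(θ))`. [cite: Ginibre1970, main theorem with the plane-rotator example cos(m·φ)] -/
def ginibreWeight (χ : ι → Ω →ₜ* Circle) (J : ι → ℝ) (θ : Ω) : ℝ :=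
  Real.exp (ginibreHamiltonian χ J θ)

/-- The Gibbs expectation `⟨F⟩_J = ∫ F e^{∑ Jₐ Re χₐ} dμ / ∫ e^{∑ Jₐ Re χₐ} dμ` relative to the a
priori measure `μ` (Haar measure in the applications). [cite: Ginibre1970, main theorem with the plane-rotator example cos(m·φ)] -/
def ginibreExpect [MeasurableSpace Ω] (μ : Measure Ω) (χ : ι → Ω →ₜ* Circle) (J : ι → ℝ)
    (F : Ω → ℝ) : ℝ :=
  (∫ θ, F θ * ginibreWeight χ J θ ∂μ) / ∫ θ, ginibreWeight χ J θ ∂μ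

/-- The Hamiltonian is continuous. [folklore] -/
theorem continuous_ginibreHamiltonian (χ : ι → Ω →ₜ* Circle) (J : ι → ℝ) :
    Continuous (ginibreHamiltonian χ J) :=
  continuous_finsetSum _ fun a _ => continuous_const.mul (continuous_reChar (χ a))

/-- The Gibbs weight is continuous. [folklore] -/
theorem continuous_ginibreWeight (χ : ι → Ω →ₜ* Circle) (J : ι → ℝ) :
    Continuous (ginibreWeight χ J) :=
  Real.continuous_exp.comp (continuous_ginibreHamiltonian χ J)

/-- The Hamiltonian is additive in the couplings. [folklore] -/
theorem ginibreHamiltonian_add (χ : ι → Ω →ₜ* Circle) (J K : ι → ℝ) (θ : Ω) :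
    ginibreHamiltonian χ (J + K) θ = ginibreHamiltonian χ J θ + ginibreHamiltonian χ K θ := by
  simp only [ginibreHamiltonian, Pi.add_apply, add_mul, Finset.sum_add_distrib]

/-- The Gibbs weight is multiplicative in the couplings. [folklore] -/
theorem ginibreWeight_add (χ : ι → Ω →ₜ* Circle) (J K : ι → ℝ) (θ : Ω) :
    ginibreWeight χ (J + K) θ = ginibreWeight χ J θ * ginibreWeight χ K θ := by
  simp only [ginibreWeight, ginibreHamiltonian_add, Real.exp_add]

/-- Duplication: `H(φψ) + H(φψ⁻¹) = 2 ∑ₐ Jₐ Re χₐ(φ) Re χₐ(ψ)`. [folklore] -/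
theorem ginibreHamiltonian_mul_add (χ : ι → Ω →ₜ* Circle) (J : ι → ℝ) (φ ψ : Ω) :
    ginibreHamiltonian χ J (φ * ψ) + ginibreHamiltonian χ J (φ * ψ⁻¹) =
      2 * ∑ a, J a * (reChar (χ a) φ * reChar (χ a) ψ) := by
  simp only [ginibreHamiltonian, ← Finset.sum_add_distrib, ← mul_add,
    reChar_mul_add_reChar_mul_inv, Finset.mul_sum]
  refine Finset.sum_congr rfl fun a _ => ?_
  ring

/-- Duplication: `H(φψ) − H(φψ⁻¹) = −2 ∑ₐ Jₐ Im χₐ(φ) Im χₐ(ψ)`. [folklore] -/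
theorem ginibreHamiltonian_mul_sub (χ : ι → Ω →ₜ* Circle) (J : ι → ℝ) (φ ψ : Ω) :
    ginibreHamiltonian χ J (φ * ψ) - ginibreHamiltonian χ J (φ * ψ⁻¹) =
      -2 * ∑ a, J a * (imChar (χ a) φ * imChar (χ a) ψ) := by
  simp only [ginibreHamiltonian, ← Finset.sum_sub_distrib, ← mul_sub,
    reChar_mul_sub_reChar_mul_inv, Finset.mul_sum]
  refine Finset.sum_congr rfl fun a _ => ?_
  ring

/-! ### The Ginibre integrand and its truncations -/

/-- Ginibre's `sin`-kernel `B(φ, ψ) = ∑ₐ δₐ Im χₐ(φ) Im χₐ(ψ)`. [folklore] -/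
def imKernel (χ : ι → Ω →ₜ* Circle) (δ : ι → ℝ) (p : Ω × Ω) : ℝ :=
  ∑ a, δ a * (imChar (χ a) p.1 * imChar (χ a) p.2)

/-- Ginibre's `cos`-kernel `C(φ, ψ) = ∑ₐ γₐ Re χₐ(φ) Re χₐ(ψ)`. [folklore] -/
def reKernel (χ : ι → Ω →ₜ* Circle) (γ : ι → ℝ) (p : Ω × Ω) : ℝ :=
  ∑ a, γ a * (reChar (χ a) p.1 * reChar (χ a) p.2)

/-- **The Ginibre integrand** `4 Im χ₀(φ) Im χ₀(ψ) · sinh B(φ,ψ) · exp C(φ,ψ)`: the pull-back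
under the duplication map of `(f(θ) − f(θ'))(e^{K(θ)} − e^{K(θ')}) e^{H(θ)+H(θ')}` for
`f = Re χ₀`, `K = ∑ δₐ Re χₐ`, `H = ∑ Jₐ Re χₐ`, with `γ = δ + 2J` (`ginibre_key`). [folklore] -/
def ginibreIntegrand (χ : ι → Ω →ₜ* Circle) (χ₀ : Ω →ₜ* Circle) (δ γ : ι → ℝ) (p : Ω × Ω) : ℝ :=
  4 * (imChar χ₀ p.1 * imChar χ₀ p.2) * (Real.sinh (imKernel χ δ p) * Real.exp (reKernel χ γ p))

/-- Truncations of the Ginibre integrand (power series of `sinh` and `exp` cut at `N`); each is a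
positive kernel (`isPosKernel_ginibreTrunc`). [folklore] -/
def ginibreTrunc (χ : ι → Ω →ₜ* Circle) (χ₀ : Ω →ₜ* Circle) (δ γ : ι → ℝ) (N : ℕ)
    (p : Ω × Ω) : ℝ :=
  4 * (imChar χ₀ p.1 * imChar χ₀ p.2) * (sinhTrunc N (imKernel χ δ p) * expTrunc N (reKernel χ γ p))

/-- `|B(φ,ψ)| ≤ ∑ₐ δₐ` for `δ ≥ 0` (`|Im χ| ≤ 1`). [folklore] -/
theorem abs_imKernel_le (χ : ι → Ω →ₜ* Circle) {δ : ι → ℝ} (hδ : ∀ a, 0 ≤ δ a) (p : Ω × Ω) :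
    |imKernel χ δ p| ≤ ∑ a, δ a := by
  unfold imKernel
  refine (Finset.abs_sum_le_sum_abs _ _).trans (Finset.sum_le_sum fun a _ => ?_)
  have h0 := hδ a
  have h1 := abs_imChar_le_one (χ a) p.1
  have h2 := abs_imChar_le_one (χ a) p.2
  rw [abs_mul, abs_of_nonneg h0, abs_mul]
  calc δ a * (|imChar (χ a) p.1| * |imChar (χ a) p.2|) ≤ δ a * (1 * 1) := by gcongr
    _ = δ a := by ring

/-- `|C(φ,ψ)| ≤ ∑ₐ γₐ` for `γ ≥ 0` (`|Re χ| ≤ 1`). [folklore] -/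
theorem abs_reKernel_le (χ : ι → Ω →ₜ* Circle) {γ : ι → ℝ} (hγ : ∀ a, 0 ≤ γ a) (p : Ω × Ω) :
    |reKernel χ γ p| ≤ ∑ a, γ a := by
  unfold reKernel
  refine (Finset.abs_sum_le_sum_abs _ _).trans (Finset.sum_le_sum fun a _ => ?_)
  have h0 := hγ a
  have h1 := abs_reChar_le_one (χ a) p.1
  have h2 := abs_reChar_le_one (χ a) p.2
  rw [abs_mul, abs_of_nonneg h0, abs_mul]
  calc γ a * (|reChar (χ a) p.1| * |reChar (χ a) p.2|) ≤ γ a * (1 * 1) := by gcongr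
    _ = γ a := by ring

/-- Uniform bound on the truncations: `|T_N| ≤ 4 sinh(∑ δ) exp(∑ γ)`. [folklore] -/
theorem abs_ginibreTrunc_le (χ : ι → Ω →ₜ* Circle) (χ₀ : Ω →ₜ* Circle) {δ γ : ι → ℝ}
    (hδ : ∀ a, 0 ≤ δ a) (hγ : ∀ a, 0 ≤ γ a) (N : ℕ) (p : Ω × Ω) :
    |ginibreTrunc χ χ₀ δ γ N p| ≤ 4 * (Real.sinh (∑ a, δ a) * Real.exp (∑ a, γ a)) := by
  have hs : |imChar χ₀ p.1 * imChar χ₀ p.2| ≤ 1 := by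
    rw [abs_mul]
    calc |imChar χ₀ p.1| * |imChar χ₀ p.2| ≤ 1 * 1 := by
          gcongr
          · exact abs_imChar_le_one _ _
          · exact abs_imChar_le_one _ _
      _ = 1 := one_mul 1
  have hB := abs_sinhTrunc_le (abs_imKernel_le χ hδ p) N
  have hC := abs_expTrunc_le (abs_reKernel_le χ hγ p) N
  have hsinh : 0 ≤ Real.sinh (∑ a, δ a) := by
    have hM : 0 ≤ ∑ a, δ a := Finset.sum_nonneg fun a _ => hδ a
    rw [Real.sinh_eq]
    have := Real.exp_le_exp.2 (by linarith : -(∑ a, δ a) ≤ ∑ a, δ a)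
    linarith
  have hSE := mul_le_mul hB hC (abs_nonneg _) hsinh
  have h3 := mul_le_mul hs hSE (by positivity) zero_le_one
  unfold ginibreTrunc
  rw [abs_mul, abs_mul, abs_of_pos (by norm_num : (0 : ℝ) < 4),
    abs_mul (sinhTrunc N (imKernel χ δ p)) (expTrunc N (reKernel χ γ p))]
  nlinarith [h3, abs_nonneg (imChar χ₀ p.1 * imChar χ₀ p.2)]

/-- Pointwise convergence of the truncations to the Ginibre integrand. [folklore] -/
theorem tendsto_ginibreTrunc (χ : ι → Ω →ₜ* Circle) (χ₀ : Ω →ₜ* Circle) (δ γ : ι → ℝ)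
    (p : Ω × Ω) :
    Tendsto (fun N => ginibreTrunc χ χ₀ δ γ N p) atTop (𝓝 (ginibreIntegrand χ χ₀ δ γ p)) :=
  ((tendsto_sinhTrunc _).mul (tendsto_expTrunc _)).const_mul _

/-- `B` is a positive kernel for `δ ≥ 0`. [folklore] -/
theorem isPosKernel_imKernel (χ : ι → Ω →ₜ* Circle) {δ : ι → ℝ} (hδ : ∀ a, 0 ≤ δ a) :
    IsPosKernel (imKernel χ δ) := by
  have : imKernel χ δ = ∑ a, fun p : Ω × Ω => δ a * (imChar (χ a) p.1 * imChar (χ a) p.2) := by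
    funext p; simp only [imKernel, Finset.sum_apply]
  rw [this]
  exact IsPosKernel.sum fun a _ => (isPosKernel_mul_self (continuous_imChar (χ a))).const_mul (hδ a)

/-- `C` is a positive kernel for `γ ≥ 0`. [folklore] -/
theorem isPosKernel_reKernel (χ : ι → Ω →ₜ* Circle) {γ : ι → ℝ} (hγ : ∀ a, 0 ≤ γ a) :
    IsPosKernel (reKernel χ γ) := by
  have : reKernel χ γ = ∑ a, fun p : Ω × Ω => γ a * (reChar (χ a) p.1 * reChar (χ a) p.2) := by
    funext p; simp only [reKernel, Finset.sum_apply]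
  rw [this]
  exact IsPosKernel.sum fun a _ => (isPosKernel_mul_self (continuous_reChar (χ a))).const_mul (hγ a)

/-- **The truncated Ginibre integrands are positive kernels** (the heart of Ginibre's proof:
after duplication every term of the double power series is `coefficient ≥ 0` times
`G(φ) G(ψ)`). [cite: Ginibre1970, main theorem with the plane-rotator example cos(m·φ)] -/
theorem isPosKernel_ginibreTrunc (χ : ι → Ω →ₜ* Circle) (χ₀ : Ω →ₜ* Circle) {δ γ : ι → ℝ}
    (hδ : ∀ a, 0 ≤ δ a) (hγ : ∀ a, 0 ≤ γ a) (N : ℕ) :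
    IsPosKernel (ginibreTrunc χ χ₀ δ γ N) :=
  ((isPosKernel_mul_self (continuous_imChar χ₀)).const_mul (by norm_num : (0 : ℝ) ≤ 4)).mul
    (((isPosKernel_imKernel χ hδ).comp_sinhTrunc N).mul ((isPosKernel_reKernel χ hγ).comp_expTrunc N))

/-- **The key pointwise identity** (Ginibre's duplication computation): with `K = ∑ δₐ Re χₐ`,
`H = ∑ Jₐ Re χₐ`, `f = Re χ₀`, `θ = φψ`, `θ' = φψ⁻¹`,
`(f(θ) − f(θ'))(e^{K(θ)} − e^{K(θ')}) e^{H(θ)} e^{H(θ')} = 4 Im χ₀(φ) Im χ₀(ψ) sinh B e^{C}`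
where `B = ∑ δₐ Im χₐ(φ) Im χₐ(ψ)` and `C = ∑ (δₐ + 2Jₐ) Re χₐ(φ) Re χₐ(ψ)`
(`cos(a+b) ± cos(a−b)`, `e^{A−B} − e^{A+B} = −2 e^{A} sinh B`). [folklore] -/
theorem ginibre_key (χ : ι → Ω →ₜ* Circle) (χ₀ : Ω →ₜ* Circle) (J δ : ι → ℝ) (φ ψ : Ω) :
    (reChar χ₀ (φ * ψ) - reChar χ₀ (φ * ψ⁻¹)) *
        (ginibreWeight χ δ (φ * ψ) - ginibreWeight χ δ (φ * ψ⁻¹)) *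
        (ginibreWeight χ J (φ * ψ) * ginibreWeight χ J (φ * ψ⁻¹)) =
      ginibreIntegrand χ χ₀ δ (fun a => δ a + 2 * J a) (φ, ψ) := by
  have h1 := ginibreHamiltonian_mul_add χ δ φ ψ
  have h2 := ginibreHamiltonian_mul_sub χ δ φ ψ
  have h3 := ginibreHamiltonian_mul_add χ J φ ψ
  have hf := reChar_mul_sub_reChar_mul_inv χ₀ φ ψ
  have hγ : reKernel χ (fun a => δ a + 2 * J a) (φ, ψ) =
      (∑ a, δ a * (reChar (χ a) φ * reChar (χ a) ψ)) +
        2 * ∑ a, J a * (reChar (χ a) φ * reChar (χ a) ψ) := by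
    simp only [reKernel, add_mul, Finset.sum_add_distrib, Finset.mul_sum]
    congr 1
    exact Finset.sum_congr rfl fun a _ => by ring
  have hBk : imKernel χ δ (φ, ψ) = ∑ a, δ a * (imChar (χ a) φ * imChar (χ a) ψ) := rfl
  set Aδ := ∑ a, δ a * (reChar (χ a) φ * reChar (χ a) ψ) with hAδ
  set AJ := ∑ a, J a * (reChar (χ a) φ * reChar (χ a) ψ) with hAJ
  set B := ∑ a, δ a * (imChar (χ a) φ * imChar (χ a) ψ) with hB
  have hu : ginibreHamiltonian χ δ (φ * ψ) = Aδ - B := by linarith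
  have hv : ginibreHamiltonian χ δ (φ * ψ⁻¹) = Aδ + B := by linarith
  have hxy : ginibreWeight χ J (φ * ψ) * ginibreWeight χ J (φ * ψ⁻¹) = Real.exp (2 * AJ) := by
    rw [ginibreWeight, ginibreWeight, ← Real.exp_add, h3]
  simp only [ginibreIntegrand]
  rw [hγ, hBk, hf, hxy, ginibreWeight, ginibreWeight, hu, hv, Real.sinh_eq, Real.exp_sub,
    Real.exp_neg, Real.exp_add, Real.exp_add]
  have hB0 : Real.exp B ≠ 0 := (Real.exp_pos B).ne'
  field_simp
  ring

variable [IsTopologicalGroup Ω]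

/-- The duplication map is continuous. [folklore] -/
theorem continuous_dupHom : Continuous (dupHom : Ω × Ω → Ω × Ω) :=
  (continuous_fst.mul continuous_snd).prodMk (continuous_fst.mul continuous_snd.inv)

end Model

end Literature.Probability.LatticeModels
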